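import Summits.AtomisticToContinuum.Crystallization.Theorems.ThreeConeCertificateSlackRigidityPricedFloorsTransport
import HarnessLib

/-!
# `SlackRigidity` (stmt-AtomisticToContinuum-11960), line `priced-floors-palm-exactification`, stub S3
# (`stub_layeredMeanSelection`): geometry of the canonical layer transport, part 2 (kernel identities)

Lead c19, S3 transport geometry, part 2: the two kernel identities of the canonical layer transport
and the re-rooting of `LayerRigid`.

* `receivedWeight_pointOf` — the layers of normal data being disjoint, the weight received from the
  pattern point `(m, i, j)` is the weight sent by the data re-rooted at layer `m`;
* `lms_transport_covariant` (registered sub-goal (T6)) — received weight in the re-rooted data = sent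
  weight (re-rooting twice is the identity, `rerootData_rerootData_neg`);
* `lms_transport_balance` (T3) — the root receives total mass `1`: the old root is a target of the
  data re-rooted at `(m, i, j)` only for `m = ∓k`, namely iff `(-i, -j)` is a near code of the layer
  `-m` of the re-rooted data; so it receives `1/2` from each of the layers `±k` (one sender of weight
  `1/2` in aligned registry, three senders of weight `1/6` in hole registry);
* `lms_layerRigid_reroot` (T5) — rigidity of the layer system passes to re-rooted sets (re-root the
  two fitting data of `S - p` back at the old root and compare root layers).

All `[folklore]` bookkeeping.
-/

noncomputable section

open MeasureTheory Filter Set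
open scoped ENNReal BigOperators Topology

namespace Summit.AtomisticToContinuum.Crystallization.Theorems.SlackRigidityPricedFloorsTransport

open Literature.MathematicalPhysics.StatisticalMechanics
open Summit.AtomisticToContinuum.Crystallization.Theorems.SlackRigidityPricedFloors
open Summit.AtomisticToContinuum.Crystallization.Theorems.LayeredHull

/-! ## The bridge and (T6) covariance -/

/-- **Bridge**: the weight received from the pattern point `(m, i, j)` is the weight sent by the data
re-rooted at layer `m`. [folklore] -/
theorem receivedWeight_pointOf {e : LData} (he : IsNormalData e) (k : ℕ) (m i j : ℤ) :
    receivedWeight k e (pointOf e m i j) =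
      transportWeight k (rerootData e m) (-(pointOf e m i j)) := by
  have h : ∃ m' : ℤ, pointOf e m i j ∈ layerOf e m' := ⟨m, pointOf_mem_layerOf e m i j⟩
  rw [receivedWeight, dif_pos h, layer_unique he h.choose_spec (pointOf_mem_layerOf e m i j)]

/-- The old root seen from the new one: `-pointOf e m i j` is the point `(-m, -i, -j)` of the
re-rooted data (`z 0 = 0`). [folklore] -/
theorem neg_pointOf_eq {e : LData} (h0 : e.2.2.2 0 = 0) (m i j : ℤ) :
    -(pointOf e m i j) = pointOf (rerootData e m) (-m) (-i) (-j) := by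
  rw [pointOf_rerootData e m (-m) (-i) (-j) i j, neg_add_cancel, neg_add_cancel, neg_add_cancel,
    pointOf_zero e h0, zero_sub]

/-- **(T6) Covariance** (registered sub-goal `lms_transport_covariant`): the weight the new root
receives from the old one equals the weight the old root sends to the new one. [folklore] -/
theorem lms_transport_covariant : ∀ (e : LData), IsNormalData e → ∀ (k : ℕ) (m i j : ℤ), receivedWeight k (rerootData e m) (-(pointOf e m i j)) = transportWeight k e (pointOf e m i j) := by
  intro e he k m i j
  rw [neg_pointOf_eq he.2.2 m i j, receivedWeight_pointOf (isNormalData_rerootData he m),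
    ← neg_pointOf_eq he.2.2 m i j, neg_neg, rerootData_rerootData_neg he.2.2]

/-! ## The old root as a target of the re-rooted data -/

/-- In the data re-rooted at layer `m`, the old root `-pointOf e m i j` is a target of layer `n` iff
`n = -m` and `(-i, -j)` is a near code of that layer. [folklore] -/
theorem neg_pointOf_mem_layerTargets_iff {e : LData} (he : IsNormalData e) (m i j n : ℤ) :
    -(pointOf e m i j) ∈ layerTargets (rerootData e m) n ↔
      n = -m ∧ (-i, -j) ∈ nearCodes (haggLabel (rerootData e m).2.2.1 (-m)) := by
  have he' := isNormalData_rerootData he m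
  rw [neg_pointOf_eq he.2.2]
  constructor
  · intro h
    obtain rfl : n = -m :=
      layer_unique he' (layerTargets_subset _ _ h) (pointOf_mem_layerOf _ _ _ _)
    exact ⟨rfl, (pointOf_mem_layerTargets_iff he' _ _ _).1 h⟩
  · rintro ⟨rfl, h⟩
    exact (pointOf_mem_layerTargets_iff he' _ _ _).2 h

/-! ## (T3) Balance: the root receives total mass one -/

/-- The indicator term of the target layer `n`, made explicit: it is supported on the source layer
`-n`, at the negatives of the near codes. [folklore] -/
theorem targetTerm_eq {e : LData} (he : IsNormalData e) (n m i j : ℤ) :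
    (if -(pointOf e m i j) ∈ layerTargets (rerootData e m) n
      then (1 : ℝ) / (layerTargets (rerootData e m) n).card else 0) =
      if m = -n ∧ (-i, -j) ∈ nearCodes (haggLabel (rerootData e (-n)).2.2.1 n)
      then (1 : ℝ) / (nearCodes (haggLabel (rerootData e (-n)).2.2.1 n)).card else 0 := by
  by_cases hm : m = -n
  · subst hm
    have key := neg_pointOf_mem_layerTargets_iff he (-n) i j n
    rw [neg_neg] at key
    rw [card_layerTargets (isNormalData_rerootData he (-n)) n, ← card_nearCodes]
    by_cases hij : (-i, -j) ∈ nearCodes (haggLabel (rerootData e (-n)).2.2.1 n)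
    · rw [if_pos (key.2 ⟨rfl, hij⟩), if_pos ⟨rfl, hij⟩]
    · rw [if_neg (fun h => hij (key.1 h).2), if_neg (fun h => hij h.2)]
  · rw [if_neg (fun h => hm ?_), if_neg (fun h => hm h.1)]
    have := ((neg_pointOf_mem_layerTargets_iff he m i j n).1 h).1
    omega

/-- The explicit indicator term has total mass one over all source points. [folklore] -/
theorem hasSum_codeTerm (n L : ℤ) :
    HasSum (fun t : ℤ × ℤ × ℤ => if t.1 = -n ∧ (-t.2.1, -t.2.2) ∈ nearCodes L
      then (1 : ℝ) / (nearCodes L).card else 0) 1 := by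
  have hNC : ((nearCodes L).card : ℝ) ≠ 0 := by
    rw [card_nearCodes]; split_ifs <;> norm_num
  have hinj : Function.Injective (fun ij : ℤ × ℤ => ((-n, -ij.1, -ij.2) : ℤ × ℤ × ℤ)) := by
    intro ij ij' h
    simp only [Prod.mk.injEq, neg_inj, true_and] at h
    exact Prod.ext h.1 h.2
  have hmem : ∀ t : ℤ × ℤ × ℤ,
      t ∈ (nearCodes L).image (fun ij : ℤ × ℤ => ((-n, -ij.1, -ij.2) : ℤ × ℤ × ℤ)) ↔
        t.1 = -n ∧ (-t.2.1, -t.2.2) ∈ nearCodes L := by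
    rintro ⟨m, i, j⟩
    simp only [Finset.mem_image, Prod.mk.injEq, Prod.exists]
    constructor
    · rintro ⟨i', j', h', rfl, rfl, rfl⟩
      simpa using h'
    · rintro ⟨rfl, h'⟩
      exact ⟨-i, -j, h', rfl, neg_neg i, neg_neg j⟩
  have h := hasSum_sum_of_ne_finset_zero (L := SummationFilter.unconditional _)
    (f := fun t : ℤ × ℤ × ℤ => if t.1 = -n ∧ (-t.2.1, -t.2.2) ∈ nearCodes L
      then (1 : ℝ) / (nearCodes L).card else 0)
    (s := (nearCodes L).image (fun ij : ℤ × ℤ => ((-n, -ij.1, -ij.2) : ℤ × ℤ × ℤ)))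
    (fun t ht => if_neg fun h' => ht ((hmem t).2 h'))
  have hval : ∀ t ∈ (nearCodes L).image (fun ij : ℤ × ℤ => ((-n, -ij.1, -ij.2) : ℤ × ℤ × ℤ)),
      (if t.1 = -n ∧ (-t.2.1, -t.2.2) ∈ nearCodes L then (1 : ℝ) / (nearCodes L).card else 0) =
        (1 : ℝ) / (nearCodes L).card := fun t ht => if_pos ((hmem t).1 ht)
  rwa [Finset.sum_congr rfl hval, Finset.sum_const, Finset.card_image_of_injective _ hinj,
    nsmul_eq_mul, mul_one_div_cancel hNC] at h

/-- Half of the mass: the indicator term of the target layer `n` has total mass one. [folklore] -/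
theorem hasSum_targetTerm {e : LData} (he : IsNormalData e) (n : ℤ) :
    HasSum (fun t : ℤ × ℤ × ℤ => if -(pointOf e t.1 t.2.1 t.2.2) ∈ layerTargets (rerootData e t.1) n
      then (1 : ℝ) / (layerTargets (rerootData e t.1) n).card else 0) 1 := by
  simp_rw [targetTerm_eq he]
  exact hasSum_codeTerm n _

/-- **(T3) Balance** (registered sub-goal `lms_transport_balance`): the root receives total mass `1`
from the pattern points. [folklore] -/
theorem lms_transport_balance : ∀ (e : LData), IsNormalData e → ∀ k : ℕ, 1 ≤ k → HasSum (fun t : ℤ × ℤ × ℤ => receivedWeight k e (pointOf e t.1 t.2.1 t.2.2)) 1 := by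
  intro e he k _
  have h := ((hasSum_targetTerm he (k : ℤ)).add (hasSum_targetTerm he (-(k : ℤ)))).mul_left (1 / 2 : ℝ)
  rw [show (1 : ℝ) / 2 * (1 + 1) = 1 by norm_num] at h
  simp_rw [receivedWeight_pointOf he]
  exact h

/-! ## (T5) Rigidity of the layer system passes to re-rooted sets -/

/-- **(T5)** (registered sub-goal `lms_layerRigid_reroot`): if any two data fitting `S` have the same
layers up to orientation, the same holds for `S - p`, `p ∈ S` (`S` fitted, hence rooted). [folklore] -/
theorem lms_layerRigid_reroot : ∀ (S : Set E3) (p : E3), LayerRigid S → p ∈ S → (∃ e : LData, Fits S e) → LayerRigid ((fun x => x - p) '' S) := by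
  rintro S p hR _ ⟨e₀, he₀⟩ f f₂ hf hf₂
  have h0S : (0 : E3) ∈ S := by
    rw [← he₀.2]
    exact ⟨0, 0, 0, (pointOf_zero e₀ he₀.1.2.2).symm⟩
  have hnp : -p ∈ (fun x => x - p) '' S := ⟨0, h0S, zero_sub p⟩
  have hnp₁ : -p ∈ dataSet f := by rw [hf.2]; exact hnp
  have hnp₂ : -p ∈ dataSet f₂ := by rw [hf₂.2]; exact hnp
  obtain ⟨m₁, i₁, j₁, h₁⟩ := (mem_dataSet_iff f (-p)).1 hnp₁
  obtain ⟨m₂, i₂, j₂, h₂⟩ := (mem_dataSet_iff f₂ (-p)).1 hnp₂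
  have hback : (fun x => x - -p) '' ((fun x => x - p) '' S) = S := by
    rw [image_image]
    simp
  have hg : Fits S (rerootData f m₁) := by
    have := lms_rerootData_fits _ f m₁ i₁ j₁ hf
    rwa [← h₁, hback] at this
  have hg₂ : Fits S (rerootData f₂ m₂) := by
    have := lms_rerootData_fits _ f₂ m₂ i₂ j₂ hf₂
    rwa [← h₂, hback] at this
  have hL : ∀ n, layerOf (rerootData f m₁) n = (fun x => x + p) '' layerOf f (n + m₁) := by
    intro n
    rw [layerOf_rerootData f m₁ n i₁ j₁, ← h₁]
    simp [sub_neg_eq_add]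
  have hL₂ : ∀ n, layerOf (rerootData f₂ m₂) n = (fun x => x + p) '' layerOf f₂ (n + m₂) := by
    intro n
    rw [layerOf_rerootData f₂ m₂ n i₂ j₂, ← h₂]
    simp [sub_neg_eq_add]
  have hinj : ∀ A B : Set E3, (fun x => x + p) '' A = (fun x => x + p) '' B → A = B :=
    fun A B h => (image_injective.2 (add_left_injective p)) h
  have h0f : (0 : E3) ∈ layerOf f 0 := ⟨0, 0, (pointOf_zero f hf.1.2.2).symm⟩
  have h0f₂ : (0 : E3) ∈ layerOf f₂ 0 := ⟨0, 0, (pointOf_zero f₂ hf₂.1.2.2).symm⟩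
  rcases hR _ _ hg hg₂ with h | h
  · have key : ∀ m, layerOf f₂ m = layerOf f (m - m₂ + m₁) := by
      intro m
      have := h (m - m₂)
      rw [hL, hL₂, sub_add_cancel] at this
      exact hinj _ _ this
    have hm : m₁ = m₂ := by
      have h00 : (0 : E3) ∈ layerOf f (0 - m₂ + m₁) := key 0 ▸ h0f₂
      have := layer_unique hf.1 h0f h00
      omega
    left
    intro m
    rw [key, hm, sub_add_cancel]
  · have key : ∀ m, layerOf f₂ m = layerOf f (-(m - m₂) + m₁) := by
      intro m
      have := h (m - m₂)
      rw [hL, hL₂, sub_add_cancel] at this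
      exact hinj _ _ this
    have hm : m₁ + m₂ = 0 := by
      have h00 : (0 : E3) ∈ layerOf f (-(0 - m₂) + m₁) := key 0 ▸ h0f₂
      have := layer_unique hf.1 h0f h00
      omega
    right
    intro m
    rw [key]
    congr 1
    omega

end Summit.AtomisticToContinuum.Crystallization.Theorems.SlackRigidityPricedFloorsTransport

end
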